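import Summits.Ventures.CertifiedArithmetic.LowPrec.GemmThetaLawE2M1FamilyWord
import Summits.Ventures.CertifiedArithmetic.LowPrec.GemmPrecRoundingG
import Summits.Ventures.CertifiedArithmetic.LowPrec.GemmThetaE2M3
import HarnessLib

/-!
# GEMM worst case LI-a — the canonical E2M3² (FP6) family for EVERY precision `p ≥ 10`:
# the word, its trajectory and its mass (grid units `2^-6`)

HONEST FRAMING: certified error envelopes and provably optimal rounding/accumulation schemes for
low-precision formats under stated cost models; every table by two implementations; no hardware or
vendor claims.

The UPPER side of the E2M3² θ-law (gemm.tex Thm. `t:thetap6`, E2M3 row) symbolically in the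
precision: the E2M1² construction of files XLIX-a/b (`GemmThetaLawE2M1FamilyWord`/`Family`)
transplanted to the 443-letter alphabet `Π(E2M3,E2M3) = piE2M3` (grid `2^-6`).  For a target
format `φ` with `p = manBits φ + 1 ≥ 10` write `K = 2^(p-10)` (`2^manBits = 512K`,
`N = 2^(p-2) = 256K`).  In GRID UNITS the family `fam6 K` is the word
  `1024^{×K} | 3^{×N} | (3,2)^{×N} (5,4)^{×N} (9,8)^{×N} (18,16)^{×N} (33,32)^{×N} (65,64)^{×N}`
  `(130,128)^{×N} (260,256)^{×N} (520,512)^{×N} (1040,1024)^{×N} | 2080 | (-2016)^∞`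
(every letter a product of two E2M3 data, `fam6_mem`): the `K` letters `16 = 4·4` are summed
EXACTLY up to `1024K = 2·2^manBits` (bottom of binade 0, spacing 2); each `3` is `spacing + tie`
from an even point, resolved up (`+4`); in binade `j = 1..10` (spacing `2^(j+1)`) the pair
`(x_j, 2^j)`, `2^j < x_j < 2^(j+1)`, advances the accumulator one grid step per letter (`x_j`
exceeds the half-spacing from an even point, `2^j` is a tie from an odd point resolved up) until
`512K·4096`, where `2080 > 2048` rounds up to `v° = (512K+1)·4096`; every later `-2016` is
absorbed (`v° - 2016 = 512K·4096 + 2080` rounds back up).  Prefix `m_p = 5377K + 1` letters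
(`= 21·2^(p-2) + 2^(p-10) + 1`, the onset of Thm. `t:thetap6` for `p ≥ 11`), mass
`L = 1058816K + 2080` (`sum_fam6Z`), end deficit `2L - v° = 20480K + 64 = 252·θ_p` grid units,
`θ_p = (5·2^manBits + 8)/252` the constant of the E2M3² law (`e2m3Law.thetaL`).  File LI-b
(`GemmThetaLawE2M3Family`) proves the trajectory (`traj6N`, via the binade-step lemma
`rneSigMag_binade_step` of file XLIX-a and the grid bridge `value_step6` below) and the closed
form of the relative error; file LII (`GemmWorstCaseE2M3Prec`) the sandwich for `W⁶_p(n)`.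
References: the E2M3² law / SUP side for every `p ≥ 12` is `thetaCert_e2m3Law`
(`GemmThetaLawGenE2M3Cert`); its `bfloat16` tight family (`p = 8`, shorter prefix) is `e2m3_1346`
(`GemmTerminalE2M3`); worst cases of recursive summation are format-by-format in the literature
([Higham2002, §4.2], [MullerEtAl2018HFPA, §6.1]; Flocq [BoldoMelquiond2011Flocq]); FP6 values
[RouhaniEtAl2023MX, Table 1].
-/

namespace Summit.Ventures.CertifiedArithmetic.LowPrec.Gemm

open Literature.ComputerArithmetic.FloatingPoint
open Literature.ComputerArithmetic.FloatingPoint.MiniFloat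
open Literature.ComputerArithmetic.FloatingPoint.MiniFloat.ThetaE2M3 (lamG)
open Finset

variable {φ : Format}

/-- Range bookkeeping: `n < 2^(m+20)` and `2^(m+14) ≤ maxRat` give `n/64 ≤ maxRat`. [folklore] -/
theorem grid6_le_maxRat (hR : (2 : ℚ) ^ (φ.manBits + 14) ≤ φ.maxRat) {n : ℕ}
    (hn : n < 2 ^ (φ.manBits + 14 + 6)) : (n : ℚ) / 64 ≤ φ.maxRat := by
  have h := grid_le_maxRat_of_lt (G := 6) (E := 14) hR (K := (n : ℤ))
    (by rw [Int.natAbs_natCast]; exact hn)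
  rw [Int.natAbs_natCast] at h
  norm_num at h
  exact h

/-- THE GRID BRIDGE on natural numbers: `fl_φ(n/64) = rneSigMag m n / 64`. [folklore] -/
theorem roundNE_grid6_nat (hq : φ.qexp ≤ -6) (hR : (2 : ℚ) ^ (φ.manBits + 14) ≤ φ.maxRat)
    {n : ℕ} (hn : n < 2 ^ (φ.manBits + 14 + 6)) :
    (roundNE φ ((n : ℚ) / 64)).toRat = (rneSigMag φ.manBits n : ℚ) / 64 := by
  have hR' : (((n : ℤ).natAbs : ℕ) : ℚ) / 2 ^ 6 ≤ φ.maxRat := by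
    rw [Int.natAbs_natCast]; norm_num; exact grid6_le_maxRat hR hn
  have h := toRat_roundNE_grid_prec (G := 6) (by exact_mod_cast hq) (n : ℤ) hR'
  rw [rneZ_natCast, Int.cast_natCast, Int.cast_natCast] at h
  norm_num at h
  exact h

/-- ONE VALUE STEP from an integer step (grid `2^-6`): if `a + c = n`, `n` is in range and
`rneSigMag m n = b`, then `fl_φ(a/64 + c/64) = b/64` and `|a/64 + c/64| ≤ maxRat`. [folklore] -/
theorem value_step6 (hq : φ.qexp ≤ -6) (hR : (2 : ℚ) ^ (φ.manBits + 14) ≤ φ.maxRat)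
    {a n b : ℕ} {c : ℤ} (hK : (a : ℤ) + c = n) (hn : n < 2 ^ (φ.manBits + 14 + 6))
    (hround : rneSigMag φ.manBits n = b) :
    (roundNE φ ((a : ℚ) / 64 + (c : ℚ) / 64)).toRat = (b : ℚ) / 64 ∧
      |(a : ℚ) / 64 + (c : ℚ) / 64| ≤ φ.maxRat := by
  have e : (a : ℚ) / 64 + (c : ℚ) / 64 = ((n : ℕ) : ℚ) / 64 := by
    have hK' : (a : ℚ) + (c : ℚ) = (n : ℚ) := by exact_mod_cast hK
    rw [← hK']; ring
  have h0 : (0 : ℚ) ≤ ((n : ℕ) : ℚ) / 64 := div_nonneg (Nat.cast_nonneg n) (by norm_num)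
  refine ⟨by rw [e, roundNE_grid6_nat hq hR hn, hround], ?_⟩
  rw [e, abs_of_nonneg h0]
  exact grid6_le_maxRat hR hn

/-- A pair block's letters: `x` at even offsets, `h` at odd ones. [cell] -/
def pairZ (x h : ℤ) (e : ℕ) : ℤ := if e % 2 = 0 then x else h

/-- The letters of blocks `6..10`, the end letter and the tail (grid units); split off `fam6Z`
to keep every `if`-chain short. [cell] -/
def fam6Zhi (K k : ℕ) : ℤ :=
  if k + 1 ≤ 3329 * K then pairZ 65 64 (k - 2817 * K)
  else if k + 1 ≤ 3841 * K then pairZ 130 128 (k - 3329 * K)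
  else if k + 1 ≤ 4353 * K then pairZ 260 256 (k - 3841 * K)
  else if k + 1 ≤ 4865 * K then pairZ 520 512 (k - 4353 * K)
  else if k + 1 ≤ 5377 * K then pairZ 1040 1024 (k - 4865 * K)
  else if k = 5377 * K then 2080
  else -2016

/-- The letters in grid units `2^-6` (see the module docstring). [cell, gemm.tex Thm. t:thetap6] -/
def fam6Z (K k : ℕ) : ℤ :=
  if k + 1 ≤ K then 1024
  else if k + 1 ≤ 257 * K then 3
  else if k + 1 ≤ 769 * K then pairZ 3 2 (k - 257 * K)
  else if k + 1 ≤ 1281 * K then pairZ 5 4 (k - 769 * K)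
  else if k + 1 ≤ 1793 * K then pairZ 9 8 (k - 1281 * K)
  else if k + 1 ≤ 2305 * K then pairZ 18 16 (k - 1793 * K)
  else if k + 1 ≤ 2817 * K then pairZ 33 32 (k - 2305 * K)
  else fam6Zhi K k

/-- The accumulator from binade 6 on (split off `traj6N` to keep every `if`-chain short):
one grid step `2^(j+1)` per letter in binade `j = 6..10`, then `v° = (512K+1)·4096`. [cell] -/
def traj6Nhi (K k : ℕ) : ℕ :=
  if k + 1 ≤ 3329 * K then 128 * (k + 1 + 512 * K - 2817 * K)
  else if k + 1 ≤ 3841 * K then 256 * (k + 1 + 512 * K - 3329 * K)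
  else if k + 1 ≤ 4353 * K then 512 * (k + 1 + 512 * K - 3841 * K)
  else if k + 1 ≤ 4865 * K then 1024 * (k + 1 + 512 * K - 4353 * K)
  else if k + 1 ≤ 5377 * K then 2048 * (k + 1 + 512 * K - 4865 * K)
  else 2097152 * K + 4096

/-- The accumulator after letter `k`, in grid units: `1024(k+1)` on the exact prefix, `+4` per
letter `3` in binade 0, one grid step `2^(j+1)` per letter in binade `j = 1..5`, then
`traj6Nhi`. [cell] -/
def traj6N (K k : ℕ) : ℕ :=
  if k + 1 ≤ K then 1024 * (k + 1)
  else if k + 1 ≤ 257 * K then 1020 * K + 4 * (k + 1)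
  else if k + 1 ≤ 769 * K then 4 * (k + 1 + 512 * K - 257 * K)
  else if k + 1 ≤ 1281 * K then 8 * (k + 1 + 512 * K - 769 * K)
  else if k + 1 ≤ 1793 * K then 16 * (k + 1 + 512 * K - 1281 * K)
  else if k + 1 ≤ 2305 * K then 32 * (k + 1 + 512 * K - 1793 * K)
  else if k + 1 ≤ 2817 * K then 64 * (k + 1 + 512 * K - 2305 * K)
  else traj6Nhi K k

/-- The family as rational data (values = grid units `/ 64`). [cell] -/
def fam6 (K k : ℕ) : ℚ := (fam6Z K k : ℚ) / 64

/-- The trajectory as rational values. [cell] -/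
def traj6 (K k : ℕ) : ℚ := (traj6N K k : ℚ) / 64

/-- Even offsets of a pair block. [cell] -/
theorem pairZ_even (x h : ℤ) {e : ℕ} (he : e % 2 = 0) : pairZ x h e = x := if_pos he

/-- Odd offsets of a pair block. [cell] -/
theorem pairZ_odd (x h : ℤ) {e : ℕ} (he : e % 2 = 1) : pairZ x h e = h :=
  if_neg (by omega)

/-- The mass of a pair block of even length. [folklore] -/
theorem sum_pairZ (x h : ℤ) (n : ℕ) : ∑ e ∈ range (2 * n), pairZ x h e = n * (x + h) := by
  simp only [pairZ]; exact sum_alt_even x h n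

/-- Prefix block: the first `K` letters are `1024` (value `16 = 4·4`). [cell] -/
theorem fam6Z_P {K k : ℕ} (h : k < K) : fam6Z K k = 1024 := by
  rw [fam6Z, if_pos (by omega)]

/-- Binade 0: `256K` letters `3` (value `3/64`). [cell] -/
theorem fam6Z_B0 {K k : ℕ} (h1 : K ≤ k) (h2 : k < 257 * K) : fam6Z K k = 3 := by
  unfold fam6Z; split_ifs <;> omega

/-- Binade 1: `(3,2)` alternating, offset form. [cell] -/
theorem fam6Z_B1 (K e : ℕ) (he : e < 512 * K) :
    fam6Z K (257 * K + e) = pairZ 3 2 e := by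
  unfold fam6Z; split_ifs <;> first | omega | (congr 1; omega)

/-- Binade 2: `(5,4)` alternating, offset form. [cell] -/
theorem fam6Z_B2 (K e : ℕ) (he : e < 512 * K) :
    fam6Z K (769 * K + e) = pairZ 5 4 e := by
  unfold fam6Z; split_ifs <;> first | omega | (congr 1; omega)

/-- Binade 3: `(9,8)` alternating, offset form. [cell] -/
theorem fam6Z_B3 (K e : ℕ) (he : e < 512 * K) :
    fam6Z K (1281 * K + e) = pairZ 9 8 e := by
  unfold fam6Z; split_ifs <;> first | omega | (congr 1; omega)

/-- Binade 4: `(18,16)` alternating, offset form. [cell] -/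
theorem fam6Z_B4 (K e : ℕ) (he : e < 512 * K) :
    fam6Z K (1793 * K + e) = pairZ 18 16 e := by
  unfold fam6Z; split_ifs <;> first | omega | (congr 1; omega)

/-- Binade 5: `(33,32)` alternating, offset form. [cell] -/
theorem fam6Z_B5 (K e : ℕ) (he : e < 512 * K) :
    fam6Z K (2305 * K + e) = pairZ 33 32 e := by
  unfold fam6Z; split_ifs <;> first | omega | (congr 1; omega)

/-- From binade 6 on the letters are read off `fam6Zhi`. [cell] -/
theorem fam6Z_hi {K k : ℕ} (h : 2817 * K ≤ k) : fam6Z K k = fam6Zhi K k := by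
  unfold fam6Z; split_ifs <;> omega

/-- Binade 6: `(65,64)` alternating, offset form. [cell] -/
theorem fam6Z_B6 (K e : ℕ) (he : e < 512 * K) :
    fam6Z K (2817 * K + e) = pairZ 65 64 e := by
  rw [fam6Z_hi (by omega)]; unfold fam6Zhi; split_ifs <;> first | omega | (congr 1; omega)

/-- Binade 7: `(130,128)` alternating, offset form. [cell] -/
theorem fam6Z_B7 (K e : ℕ) (he : e < 512 * K) :
    fam6Z K (3329 * K + e) = pairZ 130 128 e := by
  rw [fam6Z_hi (by omega)]; unfold fam6Zhi; split_ifs <;> first | omega | (congr 1; omega)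

/-- Binade 8: `(260,256)` alternating, offset form. [cell] -/
theorem fam6Z_B8 (K e : ℕ) (he : e < 512 * K) :
    fam6Z K (3841 * K + e) = pairZ 260 256 e := by
  rw [fam6Z_hi (by omega)]; unfold fam6Zhi; split_ifs <;> first | omega | (congr 1; omega)

/-- Binade 9: `(520,512)` alternating, offset form. [cell] -/
theorem fam6Z_B9 (K e : ℕ) (he : e < 512 * K) :
    fam6Z K (4353 * K + e) = pairZ 520 512 e := by
  rw [fam6Z_hi (by omega)]; unfold fam6Zhi; split_ifs <;> first | omega | (congr 1; omega)

/-- Binade 10: `(1040,1024)` alternating, offset form. [cell] -/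
theorem fam6Z_B10 (K e : ℕ) (he : e < 512 * K) :
    fam6Z K (4865 * K + e) = pairZ 1040 1024 e := by
  rw [fam6Z_hi (by omega)]; unfold fam6Zhi; split_ifs <;> first | omega | (congr 1; omega)

/-- The end letter `2080` (value `65/2 = 6.5·5`) reaching `v°`. [cell] -/
theorem fam6Z_E (K : ℕ) : fam6Z K (5377 * K) = 2080 := by
  rw [fam6Z_hi (by omega)]; unfold fam6Zhi; split_ifs <;> omega

/-- The absorbed tail: every later letter is `-2016` (value `-63/2 = -7·4.5`). [cell] -/
theorem fam6Z_tail {K k : ℕ} (h : 5377 * K < k) : fam6Z K k = -2016 := by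
  rw [fam6Z_hi (by omega)]; unfold fam6Zhi; split_ifs <;> omega

/-- Trajectory on the prefix block: exact sums `1024(k+1)`. [cell] -/
theorem traj6N_P {K k : ℕ} (h : k + 1 ≤ K) : traj6N K k = 1024 * (k + 1) := by
  unfold traj6N; rw [if_pos h]

/-- Trajectory through binade 0: `+4` per letter from `1024K`. [cell] -/
theorem traj6N_B0 {K k : ℕ} (h1 : K ≤ k + 1) (h2 : k + 1 ≤ 257 * K) :
    traj6N K k = 1020 * K + 4 * (k + 1) := by
  unfold traj6N; split_ifs <;> omega

/-- Trajectory through binade 1: spacing `4` (grid units). [cell] -/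
theorem traj6N_T1 {K k : ℕ} (h1 : 257 * K ≤ k + 1) (h2 : k + 1 ≤ 769 * K) :
    traj6N K k = 4 * (k + 1 + 512 * K - 257 * K) := by
  unfold traj6N; split_ifs <;> omega

/-- Trajectory through binade 2: spacing `8` (grid units). [cell] -/
theorem traj6N_T2 {K k : ℕ} (h1 : 769 * K ≤ k + 1) (h2 : k + 1 ≤ 1281 * K) :
    traj6N K k = 8 * (k + 1 + 512 * K - 769 * K) := by
  unfold traj6N; split_ifs <;> omega

/-- Trajectory through binade 3: spacing `16` (grid units). [cell] -/
theorem traj6N_T3 {K k : ℕ} (h1 : 1281 * K ≤ k + 1) (h2 : k + 1 ≤ 1793 * K) :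
    traj6N K k = 16 * (k + 1 + 512 * K - 1281 * K) := by
  unfold traj6N; split_ifs <;> omega

/-- Trajectory through binade 4: spacing `32` (grid units). [cell] -/
theorem traj6N_T4 {K k : ℕ} (h1 : 1793 * K ≤ k + 1) (h2 : k + 1 ≤ 2305 * K) :
    traj6N K k = 32 * (k + 1 + 512 * K - 1793 * K) := by
  unfold traj6N; split_ifs <;> omega

/-- Trajectory through binade 5: spacing `64` (grid units). [cell] -/
theorem traj6N_T5 {K k : ℕ} (h1 : 2305 * K ≤ k + 1) (h2 : k + 1 ≤ 2817 * K) :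
    traj6N K k = 64 * (k + 1 + 512 * K - 2305 * K) := by
  unfold traj6N; split_ifs <;> omega

/-- Trajectory through binade 6: spacing `128` (grid units). [cell] -/
theorem traj6N_T6 {K k : ℕ} (h1 : 2817 * K ≤ k + 1) (h2 : k + 1 ≤ 3329 * K) :
    traj6N K k = 128 * (k + 1 + 512 * K - 2817 * K) := by
  unfold traj6N; split_ifs <;> first | omega | (unfold traj6Nhi; split_ifs; omega)

/-- Trajectory through binade 7: spacing `256` (grid units). [cell] -/
theorem traj6N_T7 {K k : ℕ} (h1 : 3329 * K ≤ k + 1) (h2 : k + 1 ≤ 3841 * K) :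
    traj6N K k = 256 * (k + 1 + 512 * K - 3329 * K) := by
  unfold traj6N; split_ifs <;> first | omega | (unfold traj6Nhi; split_ifs <;> omega)

/-- Trajectory through binade 8: spacing `512` (grid units). [cell] -/
theorem traj6N_T8 {K k : ℕ} (h1 : 3841 * K ≤ k + 1) (h2 : k + 1 ≤ 4353 * K) :
    traj6N K k = 512 * (k + 1 + 512 * K - 3841 * K) := by
  unfold traj6N; split_ifs <;> first | omega | (unfold traj6Nhi; split_ifs <;> omega)

/-- Trajectory through binade 9: spacing `1024` (grid units). [cell] -/
theorem traj6N_T9 {K k : ℕ} (h1 : 4353 * K ≤ k + 1) (h2 : k + 1 ≤ 4865 * K) :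
    traj6N K k = 1024 * (k + 1 + 512 * K - 4353 * K) := by
  unfold traj6N; split_ifs <;> first | omega | (unfold traj6Nhi; split_ifs <;> omega)

/-- Trajectory through binade 10: spacing `2048` (grid units). [cell] -/
theorem traj6N_T10 {K k : ℕ} (h1 : 4865 * K ≤ k + 1) (h2 : k + 1 ≤ 5377 * K) :
    traj6N K k = 2048 * (k + 1 + 512 * K - 4865 * K) := by
  unfold traj6N; split_ifs <;> first | omega | (unfold traj6Nhi; split_ifs <;> omega)

/-- The final state `v° = (512K+1)·4096` grid units, kept forever. [cell] -/
theorem traj6N_F {K k : ℕ} (h : 5377 * K ≤ k) : traj6N K k = 2097152 * K + 4096 := by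
  unfold traj6N; split_ifs <;> first | omega | (unfold traj6Nhi; split_ifs <;> omega)

/-- Every state is at most `v° < 2^(m+20) = 536870912K`. [cell] -/
theorem traj6N_le (K k : ℕ) : traj6N K k ≤ 2097152 * K + 4096 := by
  unfold traj6N; split_ifs <;> first | omega | (unfold traj6Nhi; split_ifs <;> omega)

/-- `K ≥ 1`, `2^(m+20) = 536870912K`, `2^(m+1) = 1024K`. [folklore] -/
theorem pow_facts6 {K : ℕ} (hM : 2 ^ φ.manBits = 512 * K) :
    1 ≤ K ∧ 2 ^ (φ.manBits + 14 + 6) = 536870912 * K ∧ 2 ^ (φ.manBits + 1) = 1024 * K := by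
  have h1 : 1 ≤ 2 ^ φ.manBits := Nat.one_le_two_pow
  refine ⟨by omega, ?_, ?_⟩
  · rw [show 2 ^ (φ.manBits + 14 + 6) = 2 ^ φ.manBits * 1048576 by ring, hM]; ring
  · rw [pow_succ, hM]; ring

/-- THE MASS OF THE PREFIX: `(1024 + 768 + 256·4129)K + 2080`. [cell, gemm.tex Thm. t:thetap6] -/
theorem sum_fam6Z (K : ℕ) : ∑ k ∈ range (5377 * K + 1), fam6Z K k = 1058816 * K + 2080 := by
  have eP : ∑ k ∈ range K, fam6Z K k = 1024 * (K : ℕ) := by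
    rw [sum_congr rfl (fun k hk => fam6Z_P (K := K) (mem_range.mp hk)), sum_const, card_range,
      nsmul_eq_mul]
    ring
  have eB0 : ∑ e ∈ range (256 * K), fam6Z K (K + e) = 3 * (256 * K : ℕ) := by
    rw [sum_congr rfl (fun e he => fam6Z_B0 (K := K) (by omega)
      (by have := mem_range.mp he; omega)), sum_const, card_range, nsmul_eq_mul]
    push_cast; ring
  have eB : ∀ (T : ℕ) (x h : ℤ), (∀ e, e < 512 * K → fam6Z K (T * K + e) = pairZ x h e) →
      ∑ e ∈ range (2 * (256 * K)), fam6Z K (T * K + e) = (256 * K : ℕ) * (x + h) := by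
    intro T x h hB
    rw [sum_congr rfl (fun e he => hB e (by have := mem_range.mp he; omega)), sum_pairZ]
  rw [sum_range_succ, fam6Z_E,
    show 5377 * K = 4865 * K + 2 * (256 * K) by ring, sum_range_add,
    eB 4865 1040 1024 (fam6Z_B10 K),
    show 4865 * K = 4353 * K + 2 * (256 * K) by ring, sum_range_add,
    eB 4353 520 512 (fam6Z_B9 K),
    show 4353 * K = 3841 * K + 2 * (256 * K) by ring, sum_range_add,
    eB 3841 260 256 (fam6Z_B8 K),
    show 3841 * K = 3329 * K + 2 * (256 * K) by ring, sum_range_add,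
    eB 3329 130 128 (fam6Z_B7 K),
    show 3329 * K = 2817 * K + 2 * (256 * K) by ring, sum_range_add,
    eB 2817 65 64 (fam6Z_B6 K),
    show 2817 * K = 2305 * K + 2 * (256 * K) by ring, sum_range_add,
    eB 2305 33 32 (fam6Z_B5 K),
    show 2305 * K = 1793 * K + 2 * (256 * K) by ring, sum_range_add,
    eB 1793 18 16 (fam6Z_B4 K),
    show 1793 * K = 1281 * K + 2 * (256 * K) by ring, sum_range_add,
    eB 1281 9 8 (fam6Z_B3 K),
    show 1281 * K = 769 * K + 2 * (256 * K) by ring, sum_range_add,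
    eB 769 5 4 (fam6Z_B2 K),
    show 769 * K = 257 * K + 2 * (256 * K) by ring, sum_range_add,
    eB 257 3 2 (fam6Z_B1 K),
    show 257 * K = K + 256 * K by ring, sum_range_add, eB0, eP]
  push_cast; ring

/-- EVERY LETTER IS IN THE PRODUCT TABLE `lamG`, and the prefix letters are positive. [cell] -/
theorem fam6Z_mem_pos (K k : ℕ) : fam6Z K k ∈ lamG ∧ (k ≤ 5377 * K → 0 < fam6Z K k) := by
  rcases (by omega : k < K ∨ (K ≤ k ∧ k < 257 * K) ∨
      (257 * K ≤ k ∧ k < 769 * K) ∨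
      (769 * K ≤ k ∧ k < 1281 * K) ∨
      (1281 * K ≤ k ∧ k < 1793 * K) ∨
      (1793 * K ≤ k ∧ k < 2305 * K) ∨
      (2305 * K ≤ k ∧ k < 2817 * K) ∨
      (2817 * K ≤ k ∧ k < 3329 * K) ∨
      (3329 * K ≤ k ∧ k < 3841 * K) ∨
      (3841 * K ≤ k ∧ k < 4353 * K) ∨
      (4353 * K ≤ k ∧ k < 4865 * K) ∨
      (4865 * K ≤ k ∧ k < 5377 * K) ∨
      k = 5377 * K ∨ 5377 * K < k) with
      h | h | h | h | h | h | h | h | h | h | h | h | h | h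
  · rw [fam6Z_P h]; exact ⟨by decide, fun _ => by decide⟩
  · rw [fam6Z_B0 h.1 h.2]; exact ⟨by decide, fun _ => by decide⟩
  · obtain ⟨e, he, rfl⟩ : ∃ e, e < 512 * K ∧ k = 257 * K + e :=
      ⟨k - 257 * K, by omega, by omega⟩
    rw [fam6Z_B1 K e he]; unfold pairZ
    exact ⟨by split <;> decide, fun _ => by split <;> decide⟩
  · obtain ⟨e, he, rfl⟩ : ∃ e, e < 512 * K ∧ k = 769 * K + e :=
      ⟨k - 769 * K, by omega, by omega⟩
    rw [fam6Z_B2 K e he]; unfold pairZ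
    exact ⟨by split <;> decide, fun _ => by split <;> decide⟩
  · obtain ⟨e, he, rfl⟩ : ∃ e, e < 512 * K ∧ k = 1281 * K + e :=
      ⟨k - 1281 * K, by omega, by omega⟩
    rw [fam6Z_B3 K e he]; unfold pairZ
    exact ⟨by split <;> decide, fun _ => by split <;> decide⟩
  · obtain ⟨e, he, rfl⟩ : ∃ e, e < 512 * K ∧ k = 1793 * K + e :=
      ⟨k - 1793 * K, by omega, by omega⟩
    rw [fam6Z_B4 K e he]; unfold pairZ
    exact ⟨by split <;> decide, fun _ => by split <;> decide⟩
  · obtain ⟨e, he, rfl⟩ : ∃ e, e < 512 * K ∧ k = 2305 * K + e :=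
      ⟨k - 2305 * K, by omega, by omega⟩
    rw [fam6Z_B5 K e he]; unfold pairZ
    exact ⟨by split <;> decide, fun _ => by split <;> decide⟩
  · obtain ⟨e, he, rfl⟩ : ∃ e, e < 512 * K ∧ k = 2817 * K + e :=
      ⟨k - 2817 * K, by omega, by omega⟩
    rw [fam6Z_B6 K e he]; unfold pairZ
    exact ⟨by split <;> decide, fun _ => by split <;> decide⟩
  · obtain ⟨e, he, rfl⟩ : ∃ e, e < 512 * K ∧ k = 3329 * K + e :=
      ⟨k - 3329 * K, by omega, by omega⟩
    rw [fam6Z_B7 K e he]; unfold pairZ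
    exact ⟨by split <;> decide, fun _ => by split <;> decide⟩
  · obtain ⟨e, he, rfl⟩ : ∃ e, e < 512 * K ∧ k = 3841 * K + e :=
      ⟨k - 3841 * K, by omega, by omega⟩
    rw [fam6Z_B8 K e he]; unfold pairZ
    exact ⟨by split <;> decide, fun _ => by split <;> decide⟩
  · obtain ⟨e, he, rfl⟩ : ∃ e, e < 512 * K ∧ k = 4353 * K + e :=
      ⟨k - 4353 * K, by omega, by omega⟩
    rw [fam6Z_B9 K e he]; unfold pairZ
    exact ⟨by split <;> decide, fun _ => by split <;> decide⟩
  · obtain ⟨e, he, rfl⟩ : ∃ e, e < 512 * K ∧ k = 4865 * K + e :=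
      ⟨k - 4865 * K, by omega, by omega⟩
    rw [fam6Z_B10 K e he]; unfold pairZ
    exact ⟨by split <;> decide, fun _ => by split <;> decide⟩
  · rw [h, fam6Z_E]; exact ⟨by decide, fun _ => by decide⟩
  · rw [fam6Z_tail h]; exact ⟨by decide, fun h' => absurd h' (by omega)⟩

/-- EVERY LETTER IS A PRODUCT OF TWO E2M3 DATA: `fam6 K k ∈ piE2M3 = lamG/2^6` (`16 = 4·4`, …,
`65/2 = 6.5·5`, `-63/2 = -7·4.5`). [cell; `piE2M3` of `GemmThetaE2M3`; RouhaniEtAl2023MX] -/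
theorem fam6_mem (K k : ℕ) : fam6 K k ∈ piE2M3 :=
  List.mem_map.mpr ⟨fam6Z K k, (fam6Z_mem_pos K k).1,
    by show ((fam6Z K k : ℤ) : ℚ) / 2 ^ 6 = _; unfold fam6; norm_num⟩

end Summit.Ventures.CertifiedArithmetic.LowPrec.Gemm
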